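import Mathlib.Analysis.Convex.Mul
import Summits.ValiantsHypothesis.ValiantsHypothesis.Theorems.LacunarySymmetroidMatrixDescartesPivotRankOneFourKillSeven

/-!
# `MatrixDescartes` census — rank-one `(2,4)₁`: the NULL-DIRECTION WINDOW LEMMA
# (a common negative direction at two points forbids roots of `det F` between them; the letter-0 needle)

HONEST FRAMING.  Object-search cell `pub-symmetroid`, seat `val-sym-mdr-p1` (generation 16); helper file `--supports` the crux item
stmt-ValiantsHypothesis-18050 (`Theses.LacunarySymmetroid.MatrixDescartes`, OPEN, on HOLD) with NO closure claim.  An INSTRUMENT for the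
rank-one `(2,4)₁` cell (`F = X^e J + ∑ₖ wₖ X^{dₖ} vₖvₖᵀ`, `J` real symmetric `2 × 2` with `det J < 0`, `wₖ ≥ 0`), of a different kind than
the lineage's Descartes / kill certificates: it is quadratic-form bookkeeping plus convexity, and it holds for EVERY exponent configuration
(no chamber hypothesis).  Nothing here bears on `MatrixDescartes` in its window, on `DoorA26` / `DoorA34`, registers / credences, or
`VP ≠ VNP`; the rank-one register is unchanged.

WHAT IS PROVED.  Write `q_z(x) := zᵀF(x)z = x^e·(zᵀJz) + ∑ₖ wₖ x^{dₖ} (vₖ·z)²` for a real vector `z` and `x > 0` — a fewnomial in `x`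
with at most ONE negative coefficient (the pivot term).
* `eval_det_rankOne_four` — `(det F)(x) = A(x)C(x) − B(x)²` with `A, B, C` the entries of the real matrix `F(x)` (via the tree's
  eleven-nomial expansion `det_rankOne_four_sum`).
* `det_neg_of_two_signs`, `exists_neg_direction` — `2 × 2` sign bookkeeping: a form taking both signs has negative determinant; a form of
  negative determinant takes a negative value.
* `eval_det_neg_of_neg_direction` — if `q_z(x) < 0` for some `z`, then `(det F)(x) < 0` (`J` indefinite supplies a positive direction).
* **`eval_det_neg_between` (WINDOW LEMMA)** — if `q_z(x₁) < 0` and `q_z(x₂) < 0` for the SAME `z` and `0 < x₁ ≤ x₂`, then `(det F)(x) < 0`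
  on the whole interval `[x₁, x₂]`; hence (`no_root_between`) `det F` has no root there.  Mechanism: `q_z(x)/x^e = zᵀJz + ∑ₖ cₖ x^{dₖ−e}`
  is a non-negative combination of integer powers, each CONVEX on `(0,∞)` (`convexOn_zpow`).
* `eval_det_neg_below_of_perp` (LETTER-0 NEEDLE) — with `z = v₀^⊥` and all other letters at exponents `≥ e`: `q_z(x₂) < 0` forces
  `(det F)(x) < 0` on all of `(0, x₂]`, i.e. the first positive root exceeds `x₂`.
READING (seat memo NULL-DIRECTION.md, evidence on the item): `{x : det F(x) < 0} = ⋃_z {x : q_z(x) < 0}` and each `{q_z < 0}` is an interval;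
the components of `{(z,x) : q_z(x) < 0}` are box-disjoint, so `Z₊ = 2N − 1` with `N` the number of negativity windows, and every window is
witnessed by one direction; the tropical count of windows on the 1/3 split is `N ≤ 3` (memo §3).  This file is the kernel form of the two
exact ingredients; the exact window count is OPEN.

[folklore] `2 × 2` quadratic forms; convexity of `x ↦ x^m` on `(0,∞)` for `m ∈ ℤ` (Mathlib `convexOn_zpow`).  No definitions, no named facts.
-/

-- `Summit.ValiantsHypothesis.ValiantsHypothesis.…` repeats a component by the D-0017 layout
-- (single-conjunct summit), which the `dupNamespace` linter flags; the name is mandated.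
set_option linter.dupNamespace false

namespace Summit.ValiantsHypothesis.ValiantsHypothesis.Theorems.LacunarySymmetroidMatrixDescartes.Pivot.NullDirection

open Polynomial Matrix Finset Set
open scoped BigOperators
open Summit.ValiantsHypothesis.ValiantsHypothesis.Theorems.LacunarySymmetroidMatrixDescartes.Pivot.TwoDirections.BlockLaw
  (det_rankOne_four_sum)

/-! ## 1. `2 × 2` sign bookkeeping -/

/-- A real binary quadratic form `a z₀² + 2b z₀z₁ + c z₁²` that takes a negative AND a positive value has `ac − b² < 0`. [folklore] -/
theorem det_neg_of_two_signs (a b c z₀ z₁ y₀ y₁ : ℝ)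
    (hz : a * z₀ ^ 2 + 2 * b * (z₀ * z₁) + c * z₁ ^ 2 < 0) (hy : 0 < a * y₀ ^ 2 + 2 * b * (y₀ * y₁) + c * y₁ ^ 2) :
    a * c - b ^ 2 < 0 := by
  by_contra h
  push Not at h
  rcases lt_trichotomy a 0 with ha | ha | ha
  · have hid : a * (a * y₀ ^ 2 + 2 * b * (y₀ * y₁) + c * y₁ ^ 2) = (a * y₀ + b * y₁) ^ 2 + (a * c - b ^ 2) * y₁ ^ 2 := by ring
    have hneg : a * (a * y₀ ^ 2 + 2 * b * (y₀ * y₁) + c * y₁ ^ 2) < 0 := mul_neg_of_neg_of_pos ha hy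
    nlinarith [sq_nonneg (a * y₀ + b * y₁), mul_nonneg h (sq_nonneg y₁)]
  · subst ha
    have hb : b = 0 := by nlinarith [sq_nonneg b]
    subst hb
    have hc1 : c * z₁ ^ 2 < 0 := by linarith
    have hc2 : 0 < c * y₁ ^ 2 := by linarith
    have hc : c < 0 := by nlinarith [sq_nonneg z₁]
    have hc' : 0 < c := by nlinarith [sq_nonneg y₁]
    linarith
  · have hid : a * (a * z₀ ^ 2 + 2 * b * (z₀ * z₁) + c * z₁ ^ 2) = (a * z₀ + b * z₁) ^ 2 + (a * c - b ^ 2) * z₁ ^ 2 := by ring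
    have hneg : a * (a * z₀ ^ 2 + 2 * b * (z₀ * z₁) + c * z₁ ^ 2) < 0 := mul_neg_of_pos_of_neg ha hz
    nlinarith [sq_nonneg (a * z₀ + b * z₁), mul_nonneg h (sq_nonneg z₁)]

/-- A real binary quadratic form with `ac − b² < 0` takes a negative value. [folklore] -/
theorem exists_neg_direction (a b c : ℝ) (h : a * c - b ^ 2 < 0) :
    ∃ z₀ z₁ : ℝ, a * z₀ ^ 2 + 2 * b * (z₀ * z₁) + c * z₁ ^ 2 < 0 := by
  rcases lt_trichotomy a 0 with ha | ha | ha
  · exact ⟨1, 0, by nlinarith⟩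
  · subst ha
    have hb : b ≠ 0 := by
      intro hb; subst hb; simp at h
    refine ⟨-(c + 1) / (2 * b), 1, ?_⟩
    have : 2 * b * (-(c + 1) / (2 * b) * 1) = -(c + 1) := by field_simp
    nlinarith [this]
  · refine ⟨b, -a, ?_⟩
    have : a * b ^ 2 + 2 * b * (b * -a) + c * (-a) ^ 2 = a * (a * c - b ^ 2) := by ring
    rw [this]
    exact mul_neg_of_pos_of_neg ha h

/-! ## 2. The rank-one `(2,4)₁` pencil evaluated at a point -/

/-- **Evaluation of `det F`.**  For `J` symmetric, `(det F)(x) = A(x)·C(x) − B(x)²` with `A, B, C` the entries of the real symmetric matrix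
`F(x) = x^e J + ∑ₖ wₖ x^{dₖ} vₖvₖᵀ`. [this file, from the tree's `det_rankOne_four_sum`] -/
theorem eval_det_rankOne_four (e d₀ d₁ d₂ d₃ : ℕ) (J : Matrix (Fin 2) (Fin 2) ℝ) (hJ : J 1 0 = J 0 1) (v₀ v₁ v₂ v₃ : Fin 2 → ℝ)
    (w₀ w₁ w₂ w₃ x : ℝ) :
    (Matrix.det (((X : ℝ[X]) ^ e) • J.map Polynomial.C
        + (Polynomial.C w₀ * X ^ d₀) • (vecMulVec v₀ v₀).map Polynomial.C
        + (Polynomial.C w₁ * X ^ d₁) • (vecMulVec v₁ v₁).map Polynomial.C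
        + (Polynomial.C w₂ * X ^ d₂) • (vecMulVec v₂ v₂).map Polynomial.C
        + (Polynomial.C w₃ * X ^ d₃) • (vecMulVec v₃ v₃).map Polynomial.C)).eval x
      = (x ^ e * J 0 0 + w₀ * x ^ d₀ * v₀ 0 ^ 2 + w₁ * x ^ d₁ * v₁ 0 ^ 2 + w₂ * x ^ d₂ * v₂ 0 ^ 2 + w₃ * x ^ d₃ * v₃ 0 ^ 2)
          * (x ^ e * J 1 1 + w₀ * x ^ d₀ * v₀ 1 ^ 2 + w₁ * x ^ d₁ * v₁ 1 ^ 2 + w₂ * x ^ d₂ * v₂ 1 ^ 2 + w₃ * x ^ d₃ * v₃ 1 ^ 2)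
        - (x ^ e * J 0 1 + w₀ * x ^ d₀ * (v₀ 0 * v₀ 1) + w₁ * x ^ d₁ * (v₁ 0 * v₁ 1) + w₂ * x ^ d₂ * (v₂ 0 * v₂ 1)
            + w₃ * x ^ d₃ * (v₃ 0 * v₃ 1)) ^ 2 := by
  rw [det_rankOne_four_sum, eval_finsetSum]
  simp only [Fin.sum_univ_succ, Fin.sum_univ_zero, Matrix.cons_val_zero, Matrix.cons_val_succ, eval_mul, eval_C, eval_pow, eval_X,
    Matrix.det_fin_two, hJ]
  ring

/-- **One negative direction ⇒ `(det F)(x) < 0`.**  If `zᵀF(x)z < 0` for some real `z` (with `J` symmetric, `det J < 0`, `wₖ ≥ 0`,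
`x > 0`), then `(det F)(x) < 0`: `F(x)` is not positive semi-definite because of `z`, and not negative semi-definite because `J` has a
positive direction and the letters are positive semi-definite. [this file] -/
theorem eval_det_neg_of_neg_direction (e d₀ d₁ d₂ d₃ : ℕ) (J : Matrix (Fin 2) (Fin 2) ℝ) (hJ : J 1 0 = J 0 1)
    (hdJ : J 0 0 * J 1 1 - J 0 1 ^ 2 < 0) (v₀ v₁ v₂ v₃ : Fin 2 → ℝ) (w₀ w₁ w₂ w₃ : ℝ) (hw₀ : 0 ≤ w₀) (hw₁ : 0 ≤ w₁) (hw₂ : 0 ≤ w₂)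
    (hw₃ : 0 ≤ w₃) (x : ℝ) (hx : 0 < x) (z₀ z₁ : ℝ)
    (hz : x ^ e * (J 0 0 * z₀ ^ 2 + 2 * J 0 1 * (z₀ * z₁) + J 1 1 * z₁ ^ 2) + w₀ * x ^ d₀ * (v₀ 0 * z₀ + v₀ 1 * z₁) ^ 2
        + w₁ * x ^ d₁ * (v₁ 0 * z₀ + v₁ 1 * z₁) ^ 2 + w₂ * x ^ d₂ * (v₂ 0 * z₀ + v₂ 1 * z₁) ^ 2
        + w₃ * x ^ d₃ * (v₃ 0 * z₀ + v₃ 1 * z₁) ^ 2 < 0) :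
    (Matrix.det (((X : ℝ[X]) ^ e) • J.map Polynomial.C
        + (Polynomial.C w₀ * X ^ d₀) • (vecMulVec v₀ v₀).map Polynomial.C
        + (Polynomial.C w₁ * X ^ d₁) • (vecMulVec v₁ v₁).map Polynomial.C
        + (Polynomial.C w₂ * X ^ d₂) • (vecMulVec v₂ v₂).map Polynomial.C
        + (Polynomial.C w₃ * X ^ d₃) • (vecMulVec v₃ v₃).map Polynomial.C)).eval x < 0 := by
  rw [eval_det_rankOne_four e d₀ d₁ d₂ d₃ J hJ]
  -- the entries of `F(x)` as atoms
  obtain ⟨A, hA⟩ : ∃ A : ℝ, A = x ^ e * J 0 0 + w₀ * x ^ d₀ * v₀ 0 ^ 2 + w₁ * x ^ d₁ * v₁ 0 ^ 2 + w₂ * x ^ d₂ * v₂ 0 ^ 2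
      + w₃ * x ^ d₃ * v₃ 0 ^ 2 := ⟨_, rfl⟩
  obtain ⟨C, hC⟩ : ∃ C : ℝ, C = x ^ e * J 1 1 + w₀ * x ^ d₀ * v₀ 1 ^ 2 + w₁ * x ^ d₁ * v₁ 1 ^ 2 + w₂ * x ^ d₂ * v₂ 1 ^ 2
      + w₃ * x ^ d₃ * v₃ 1 ^ 2 := ⟨_, rfl⟩
  obtain ⟨B, hB⟩ : ∃ B : ℝ, B = x ^ e * J 0 1 + w₀ * x ^ d₀ * (v₀ 0 * v₀ 1) + w₁ * x ^ d₁ * (v₁ 0 * v₁ 1) + w₂ * x ^ d₂ * (v₂ 0 * v₂ 1)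
      + w₃ * x ^ d₃ * (v₃ 0 * v₃ 1) := ⟨_, rfl⟩
  rw [← hA, ← hB, ← hC]
  -- the form of `F(x)` at a vector `(y₀, y₁)`
  have hform : ∀ y₀ y₁ : ℝ, A * y₀ ^ 2 + 2 * B * (y₀ * y₁) + C * y₁ ^ 2
      = x ^ e * (J 0 0 * y₀ ^ 2 + 2 * J 0 1 * (y₀ * y₁) + J 1 1 * y₁ ^ 2) + w₀ * x ^ d₀ * (v₀ 0 * y₀ + v₀ 1 * y₁) ^ 2
        + w₁ * x ^ d₁ * (v₁ 0 * y₀ + v₁ 1 * y₁) ^ 2 + w₂ * x ^ d₂ * (v₂ 0 * y₀ + v₂ 1 * y₁) ^ 2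
        + w₃ * x ^ d₃ * (v₃ 0 * y₀ + v₃ 1 * y₁) ^ 2 := by
    intro y₀ y₁; rw [hA, hB, hC]; ring
  -- a positive direction from `det J < 0`
  have hdJ' : (-J 0 0) * (-J 1 1) - (-J 0 1) ^ 2 < 0 := by
    have : (-J 0 0) * (-J 1 1) - (-J 0 1) ^ 2 = J 0 0 * J 1 1 - J 0 1 ^ 2 := by ring
    rw [this]; exact hdJ
  obtain ⟨y₀, y₁, hy⟩ := exists_neg_direction (-J 0 0) (-J 0 1) (-J 1 1) hdJ'
  have hypos : 0 < J 0 0 * y₀ ^ 2 + 2 * J 0 1 * (y₀ * y₁) + J 1 1 * y₁ ^ 2 := by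
    have : (-J 0 0) * y₀ ^ 2 + 2 * (-J 0 1) * (y₀ * y₁) + (-J 1 1) * y₁ ^ 2
        = -(J 0 0 * y₀ ^ 2 + 2 * J 0 1 * (y₀ * y₁) + J 1 1 * y₁ ^ 2) := by ring
    linarith
  have hxe : 0 < x ^ e := pow_pos hx e
  have hyF : 0 < A * y₀ ^ 2 + 2 * B * (y₀ * y₁) + C * y₁ ^ 2 := by
    rw [hform]
    have t0 : 0 ≤ w₀ * x ^ d₀ * (v₀ 0 * y₀ + v₀ 1 * y₁) ^ 2 := by positivity
    have t1 : 0 ≤ w₁ * x ^ d₁ * (v₁ 0 * y₀ + v₁ 1 * y₁) ^ 2 := by positivity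
    have t2 : 0 ≤ w₂ * x ^ d₂ * (v₂ 0 * y₀ + v₂ 1 * y₁) ^ 2 := by positivity
    have t3 : 0 ≤ w₃ * x ^ d₃ * (v₃ 0 * y₀ + v₃ 1 * y₁) ^ 2 := by positivity
    have hp := mul_pos hxe hypos
    linarith
  have hzF : A * z₀ ^ 2 + 2 * B * (z₀ * z₁) + C * z₁ ^ 2 < 0 := by rw [hform]; exact hz
  exact det_neg_of_two_signs A B C z₀ z₁ y₀ y₁ hzF hyF

/-! ## 3. The window lemma -/

/-- **WINDOW LEMMA.**  If the SAME real direction `z` is negative for `F` at two points `0 < x₁ ≤ x₂` (`zᵀF(x₁)z < 0` and `zᵀF(x₂)z < 0`),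
then `(det F)(x) < 0` for every `x ∈ [x₁, x₂]` (`J` symmetric with `det J < 0`, weights `≥ 0`, ANY exponents).  Mechanism:
`zᵀF(x)z / x^e = zᵀJz + ∑ₖ wₖ (vₖ·z)² x^{dₖ−e}` is convex on `(0,∞)` (integer powers), so it stays negative between two points where it is
negative. [this file] -/
theorem eval_det_neg_between (e d₀ d₁ d₂ d₃ : ℕ) (J : Matrix (Fin 2) (Fin 2) ℝ) (hJ : J 1 0 = J 0 1)
    (hdJ : J 0 0 * J 1 1 - J 0 1 ^ 2 < 0) (v₀ v₁ v₂ v₃ : Fin 2 → ℝ) (w₀ w₁ w₂ w₃ : ℝ) (hw₀ : 0 ≤ w₀) (hw₁ : 0 ≤ w₁) (hw₂ : 0 ≤ w₂)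
    (hw₃ : 0 ≤ w₃) (z₀ z₁ x₁ x₂ : ℝ) (hx₁ : 0 < x₁) (hx₁₂ : x₁ ≤ x₂)
    (h₁ : x₁ ^ e * (J 0 0 * z₀ ^ 2 + 2 * J 0 1 * (z₀ * z₁) + J 1 1 * z₁ ^ 2) + w₀ * x₁ ^ d₀ * (v₀ 0 * z₀ + v₀ 1 * z₁) ^ 2
        + w₁ * x₁ ^ d₁ * (v₁ 0 * z₀ + v₁ 1 * z₁) ^ 2 + w₂ * x₁ ^ d₂ * (v₂ 0 * z₀ + v₂ 1 * z₁) ^ 2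
        + w₃ * x₁ ^ d₃ * (v₃ 0 * z₀ + v₃ 1 * z₁) ^ 2 < 0)
    (h₂ : x₂ ^ e * (J 0 0 * z₀ ^ 2 + 2 * J 0 1 * (z₀ * z₁) + J 1 1 * z₁ ^ 2) + w₀ * x₂ ^ d₀ * (v₀ 0 * z₀ + v₀ 1 * z₁) ^ 2
        + w₁ * x₂ ^ d₁ * (v₁ 0 * z₀ + v₁ 1 * z₁) ^ 2 + w₂ * x₂ ^ d₂ * (v₂ 0 * z₀ + v₂ 1 * z₁) ^ 2
        + w₃ * x₂ ^ d₃ * (v₃ 0 * z₀ + v₃ 1 * z₁) ^ 2 < 0)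
    (x : ℝ) (hx₁x : x₁ ≤ x) (hxx₂ : x ≤ x₂) :
    (Matrix.det (((X : ℝ[X]) ^ e) • J.map Polynomial.C
        + (Polynomial.C w₀ * X ^ d₀) • (vecMulVec v₀ v₀).map Polynomial.C
        + (Polynomial.C w₁ * X ^ d₁) • (vecMulVec v₁ v₁).map Polynomial.C
        + (Polynomial.C w₂ * X ^ d₂) • (vecMulVec v₂ v₂).map Polynomial.C
        + (Polynomial.C w₃ * X ^ d₃) • (vecMulVec v₃ v₃).map Polynomial.C)).eval x < 0 := by
  have hx : 0 < x := lt_of_lt_of_le hx₁ hx₁x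
  have hx₂ : 0 < x₂ := lt_of_lt_of_le hx₁ hx₁₂
  -- abbreviations for the `z`-dependent non-negative coefficients and the pivot form
  set QJ := J 0 0 * z₀ ^ 2 + 2 * J 0 1 * (z₀ * z₁) + J 1 1 * z₁ ^ 2 with hQJ
  set c₀ := w₀ * (v₀ 0 * z₀ + v₀ 1 * z₁) ^ 2 with hc₀
  set c₁ := w₁ * (v₁ 0 * z₀ + v₁ 1 * z₁) ^ 2 with hc₁
  set c₂ := w₂ * (v₂ 0 * z₀ + v₂ 1 * z₁) ^ 2 with hc₂
  set c₃ := w₃ * (v₃ 0 * z₀ + v₃ 1 * z₁) ^ 2 with hc₃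
  have hc₀' : 0 ≤ c₀ := by positivity
  have hc₁' : 0 ≤ c₁ := by positivity
  have hc₂' : 0 ≤ c₂ := by positivity
  have hc₃' : 0 ≤ c₃ := by positivity
  -- the reduced (convex) function `g(y) = zᵀF(y)z / y^e`
  have hg : ConvexOn ℝ (Ioi (0 : ℝ))
      ((((fun _ : ℝ => QJ) + fun y : ℝ => c₀ • y ^ ((d₀ : ℤ) - e)) + fun y : ℝ => c₁ • y ^ ((d₁ : ℤ) - e))
        + (fun y : ℝ => c₂ • y ^ ((d₂ : ℤ) - e)) + fun y : ℝ => c₃ • y ^ ((d₃ : ℤ) - e)) :=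
    ((((convexOn_const QJ (convex_Ioi 0)).add ((convexOn_zpow _).smul hc₀')).add ((convexOn_zpow _).smul hc₁')).add
      ((convexOn_zpow _).smul hc₂')).add ((convexOn_zpow _).smul hc₃')
  -- `y^e · y^{d−e} = y^d` for `y > 0`
  have hpow : ∀ y : ℝ, 0 < y → ∀ n : ℕ, y ^ e * y ^ ((n : ℤ) - e) = y ^ n := by
    intro y hy n
    rw [← zpow_natCast y e, ← zpow_add₀ hy.ne', show ((e : ℤ) + ((n : ℤ) - e)) = n by ring, zpow_natCast]
  -- the form equals `y^e · g(y)`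
  have hrel : ∀ y : ℝ, 0 < y →
      y ^ e * (J 0 0 * z₀ ^ 2 + 2 * J 0 1 * (z₀ * z₁) + J 1 1 * z₁ ^ 2) + w₀ * y ^ d₀ * (v₀ 0 * z₀ + v₀ 1 * z₁) ^ 2
        + w₁ * y ^ d₁ * (v₁ 0 * z₀ + v₁ 1 * z₁) ^ 2 + w₂ * y ^ d₂ * (v₂ 0 * z₀ + v₂ 1 * z₁) ^ 2
        + w₃ * y ^ d₃ * (v₃ 0 * z₀ + v₃ 1 * z₁) ^ 2
      = y ^ e * ((((fun _ : ℝ => QJ) + fun y : ℝ => c₀ • y ^ ((d₀ : ℤ) - e)) + fun y : ℝ => c₁ • y ^ ((d₁ : ℤ) - e))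
        + (fun y : ℝ => c₂ • y ^ ((d₂ : ℤ) - e)) + fun y : ℝ => c₃ • y ^ ((d₃ : ℤ) - e)) y := by
    intro y hy
    simp only [Pi.add_apply, smul_eq_mul]
    rw [← hpow y hy d₀, ← hpow y hy d₁, ← hpow y hy d₂, ← hpow y hy d₃, hQJ, hc₀, hc₁, hc₂, hc₃]
    ring
  -- `g < 0` at the two end points
  have hg₁ : ((((fun _ : ℝ => QJ) + fun y : ℝ => c₀ • y ^ ((d₀ : ℤ) - e)) + fun y : ℝ => c₁ • y ^ ((d₁ : ℤ) - e))
        + (fun y : ℝ => c₂ • y ^ ((d₂ : ℤ) - e)) + fun y : ℝ => c₃ • y ^ ((d₃ : ℤ) - e)) x₁ < 0 := by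
    by_contra hc
    push Not at hc
    have := mul_nonneg (pow_pos hx₁ e).le hc
    linarith [hrel x₁ hx₁]
  have hg₂ : ((((fun _ : ℝ => QJ) + fun y : ℝ => c₀ • y ^ ((d₀ : ℤ) - e)) + fun y : ℝ => c₁ • y ^ ((d₁ : ℤ) - e))
        + (fun y : ℝ => c₂ • y ^ ((d₂ : ℤ) - e)) + fun y : ℝ => c₃ • y ^ ((d₃ : ℤ) - e)) x₂ < 0 := by
    by_contra hc
    push Not at hc
    have := mul_nonneg (pow_pos hx₂ e).le hc
    linarith [hrel x₂ hx₂]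
  -- convexity on the segment
  have hseg : x ∈ segment ℝ x₁ x₂ := by
    rw [segment_eq_Icc hx₁₂]; exact ⟨hx₁x, hxx₂⟩
  have hle := hg.le_on_segment (mem_Ioi.mpr hx₁) (mem_Ioi.mpr hx₂) hseg
  have hgx : ((((fun _ : ℝ => QJ) + fun y : ℝ => c₀ • y ^ ((d₀ : ℤ) - e)) + fun y : ℝ => c₁ • y ^ ((d₁ : ℤ) - e))
        + (fun y : ℝ => c₂ • y ^ ((d₂ : ℤ) - e)) + fun y : ℝ => c₃ • y ^ ((d₃ : ℤ) - e)) x < 0 :=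
    lt_of_le_of_lt hle (max_lt hg₁ hg₂)
  have hzx : x ^ e * (J 0 0 * z₀ ^ 2 + 2 * J 0 1 * (z₀ * z₁) + J 1 1 * z₁ ^ 2) + w₀ * x ^ d₀ * (v₀ 0 * z₀ + v₀ 1 * z₁) ^ 2
        + w₁ * x ^ d₁ * (v₁ 0 * z₀ + v₁ 1 * z₁) ^ 2 + w₂ * x ^ d₂ * (v₂ 0 * z₀ + v₂ 1 * z₁) ^ 2
        + w₃ * x ^ d₃ * (v₃ 0 * z₀ + v₃ 1 * z₁) ^ 2 < 0 := by
    rw [hrel x hx]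
    exact mul_neg_of_pos_of_neg (pow_pos hx e) hgx
  exact eval_det_neg_of_neg_direction e d₀ d₁ d₂ d₃ J hJ hdJ v₀ v₁ v₂ v₃ w₀ w₁ w₂ w₃ hw₀ hw₁ hw₂ hw₃ x hx z₀ z₁ hzx

/-- **No root between two points sharing a negative direction** (`roots` form of the window lemma): under the hypotheses of
`eval_det_neg_between`, no root of `det F` lies in `[x₁, x₂]`. [this file] -/
theorem no_root_between (e d₀ d₁ d₂ d₃ : ℕ) (J : Matrix (Fin 2) (Fin 2) ℝ) (hJ : J 1 0 = J 0 1)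
    (hdJ : J 0 0 * J 1 1 - J 0 1 ^ 2 < 0) (v₀ v₁ v₂ v₃ : Fin 2 → ℝ) (w₀ w₁ w₂ w₃ : ℝ) (hw₀ : 0 ≤ w₀) (hw₁ : 0 ≤ w₁) (hw₂ : 0 ≤ w₂)
    (hw₃ : 0 ≤ w₃) (z₀ z₁ x₁ x₂ : ℝ) (hx₁ : 0 < x₁) (hx₁₂ : x₁ ≤ x₂)
    (h₁ : x₁ ^ e * (J 0 0 * z₀ ^ 2 + 2 * J 0 1 * (z₀ * z₁) + J 1 1 * z₁ ^ 2) + w₀ * x₁ ^ d₀ * (v₀ 0 * z₀ + v₀ 1 * z₁) ^ 2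
        + w₁ * x₁ ^ d₁ * (v₁ 0 * z₀ + v₁ 1 * z₁) ^ 2 + w₂ * x₁ ^ d₂ * (v₂ 0 * z₀ + v₂ 1 * z₁) ^ 2
        + w₃ * x₁ ^ d₃ * (v₃ 0 * z₀ + v₃ 1 * z₁) ^ 2 < 0)
    (h₂ : x₂ ^ e * (J 0 0 * z₀ ^ 2 + 2 * J 0 1 * (z₀ * z₁) + J 1 1 * z₁ ^ 2) + w₀ * x₂ ^ d₀ * (v₀ 0 * z₀ + v₀ 1 * z₁) ^ 2
        + w₁ * x₂ ^ d₁ * (v₁ 0 * z₀ + v₁ 1 * z₁) ^ 2 + w₂ * x₂ ^ d₂ * (v₂ 0 * z₀ + v₂ 1 * z₁) ^ 2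
        + w₃ * x₂ ^ d₃ * (v₃ 0 * z₀ + v₃ 1 * z₁) ^ 2 < 0)
    (x : ℝ) (hroot : x ∈ (Matrix.det (((X : ℝ[X]) ^ e) • J.map Polynomial.C
        + (Polynomial.C w₀ * X ^ d₀) • (vecMulVec v₀ v₀).map Polynomial.C
        + (Polynomial.C w₁ * X ^ d₁) • (vecMulVec v₁ v₁).map Polynomial.C
        + (Polynomial.C w₂ * X ^ d₂) • (vecMulVec v₂ v₂).map Polynomial.C
        + (Polynomial.C w₃ * X ^ d₃) • (vecMulVec v₃ v₃).map Polynomial.C)).roots) :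
    ¬ (x₁ ≤ x ∧ x ≤ x₂) := by
  rintro ⟨hx₁x, hxx₂⟩
  have hlt := eval_det_neg_between e d₀ d₁ d₂ d₃ J hJ hdJ v₀ v₁ v₂ v₃ w₀ w₁ w₂ w₃ hw₀ hw₁ hw₂ hw₃ z₀ z₁ x₁ x₂ hx₁ hx₁₂ h₁ h₂ x
    hx₁x hxx₂
  have h0 := (mem_roots'.1 hroot).2
  rw [IsRoot.def] at h0
  exact absurd h0 hlt.ne

/-! ## 4. The letter-0 needle -/

/-- **LETTER-0 NEEDLE.**  With the direction `z = v₀^⊥` (so letter `0` is invisible) and the other letters at exponents `≥ e`, the reduced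
form `v₀^⊥ᵀF(x)v₀^⊥ / x^e = m₀ + ∑_{k≥1} wₖ Δ₀ₖ² x^{dₖ−e}` is non-decreasing in `x`; so if it is negative at `x₂`, then `(det F)(x) < 0` on
all of `(0, x₂]` — the first positive root of `det F` is larger than `x₂`.  (`m₀ = J₀₀v₀₁² − 2J₀₁v₀₀v₀₁ + J₁₁v₀₀² < 0` is the pairing of
the core letter `0` with the pivot.) [this file] -/
theorem eval_det_neg_below_of_perp (e d₀ d₁ d₂ d₃ : ℕ) (he1 : e ≤ d₁) (he2 : e ≤ d₂) (he3 : e ≤ d₃) (J : Matrix (Fin 2) (Fin 2) ℝ)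
    (hJ : J 1 0 = J 0 1) (hdJ : J 0 0 * J 1 1 - J 0 1 ^ 2 < 0) (v₀ v₁ v₂ v₃ : Fin 2 → ℝ) (w₀ w₁ w₂ w₃ : ℝ) (hw₀ : 0 ≤ w₀)
    (hw₁ : 0 ≤ w₁) (hw₂ : 0 ≤ w₂) (hw₃ : 0 ≤ w₃) (x₂ : ℝ)
    (h₂ : (J 0 0 * v₀ 1 ^ 2 - 2 * J 0 1 * (v₀ 1 * v₀ 0) + J 1 1 * v₀ 0 ^ 2)
        + w₁ * x₂ ^ (d₁ - e) * (v₁ 0 * v₀ 1 - v₁ 1 * v₀ 0) ^ 2 + w₂ * x₂ ^ (d₂ - e) * (v₂ 0 * v₀ 1 - v₂ 1 * v₀ 0) ^ 2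
        + w₃ * x₂ ^ (d₃ - e) * (v₃ 0 * v₀ 1 - v₃ 1 * v₀ 0) ^ 2 < 0)
    (x : ℝ) (hx : 0 < x) (hxx₂ : x ≤ x₂) :
    (Matrix.det (((X : ℝ[X]) ^ e) • J.map Polynomial.C
        + (Polynomial.C w₀ * X ^ d₀) • (vecMulVec v₀ v₀).map Polynomial.C
        + (Polynomial.C w₁ * X ^ d₁) • (vecMulVec v₁ v₁).map Polynomial.C
        + (Polynomial.C w₂ * X ^ d₂) • (vecMulVec v₂ v₂).map Polynomial.C
        + (Polynomial.C w₃ * X ^ d₃) • (vecMulVec v₃ v₃).map Polynomial.C)).eval x < 0 := by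
  -- monotonicity of the reduced form from `x` up to `x₂`
  have hm1 : x ^ (d₁ - e) ≤ x₂ ^ (d₁ - e) := pow_le_pow_left₀ hx.le hxx₂ _
  have hm2 : x ^ (d₂ - e) ≤ x₂ ^ (d₂ - e) := pow_le_pow_left₀ hx.le hxx₂ _
  have hm3 : x ^ (d₃ - e) ≤ x₂ ^ (d₃ - e) := pow_le_pow_left₀ hx.le hxx₂ _
  have t1 : 0 ≤ w₁ * (v₁ 0 * v₀ 1 - v₁ 1 * v₀ 0) ^ 2 := by positivity
  have t2 : 0 ≤ w₂ * (v₂ 0 * v₀ 1 - v₂ 1 * v₀ 0) ^ 2 := by positivity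
  have t3 : 0 ≤ w₃ * (v₃ 0 * v₀ 1 - v₃ 1 * v₀ 0) ^ 2 := by positivity
  have hred : (J 0 0 * v₀ 1 ^ 2 - 2 * J 0 1 * (v₀ 1 * v₀ 0) + J 1 1 * v₀ 0 ^ 2)
        + w₁ * x ^ (d₁ - e) * (v₁ 0 * v₀ 1 - v₁ 1 * v₀ 0) ^ 2 + w₂ * x ^ (d₂ - e) * (v₂ 0 * v₀ 1 - v₂ 1 * v₀ 0) ^ 2
        + w₃ * x ^ (d₃ - e) * (v₃ 0 * v₀ 1 - v₃ 1 * v₀ 0) ^ 2 < 0 := by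
    nlinarith [mul_le_mul_of_nonneg_left hm1 t1, mul_le_mul_of_nonneg_left hm2 t2, mul_le_mul_of_nonneg_left hm3 t3]
  -- the full form at `z = v₀^⊥ = (v₀ 1, -v₀ 0)` is `x^e ·` (reduced form)
  have hp1 : x ^ d₁ = x ^ e * x ^ (d₁ - e) := by rw [← pow_add, Nat.add_sub_cancel' he1]
  have hp2 : x ^ d₂ = x ^ e * x ^ (d₂ - e) := by rw [← pow_add, Nat.add_sub_cancel' he2]
  have hp3 : x ^ d₃ = x ^ e * x ^ (d₃ - e) := by rw [← pow_add, Nat.add_sub_cancel' he3]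
  have hz : x ^ e * (J 0 0 * (v₀ 1) ^ 2 + 2 * J 0 1 * (v₀ 1 * (-v₀ 0)) + J 1 1 * (-v₀ 0) ^ 2)
        + w₀ * x ^ d₀ * (v₀ 0 * v₀ 1 + v₀ 1 * (-v₀ 0)) ^ 2
        + w₁ * x ^ d₁ * (v₁ 0 * v₀ 1 + v₁ 1 * (-v₀ 0)) ^ 2 + w₂ * x ^ d₂ * (v₂ 0 * v₀ 1 + v₂ 1 * (-v₀ 0)) ^ 2
        + w₃ * x ^ d₃ * (v₃ 0 * v₀ 1 + v₃ 1 * (-v₀ 0)) ^ 2 < 0 := by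
    have hid : x ^ e * (J 0 0 * (v₀ 1) ^ 2 + 2 * J 0 1 * (v₀ 1 * (-v₀ 0)) + J 1 1 * (-v₀ 0) ^ 2)
        + w₀ * x ^ d₀ * (v₀ 0 * v₀ 1 + v₀ 1 * (-v₀ 0)) ^ 2
        + w₁ * x ^ d₁ * (v₁ 0 * v₀ 1 + v₁ 1 * (-v₀ 0)) ^ 2 + w₂ * x ^ d₂ * (v₂ 0 * v₀ 1 + v₂ 1 * (-v₀ 0)) ^ 2
        + w₃ * x ^ d₃ * (v₃ 0 * v₀ 1 + v₃ 1 * (-v₀ 0)) ^ 2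
        = x ^ e * ((J 0 0 * v₀ 1 ^ 2 - 2 * J 0 1 * (v₀ 1 * v₀ 0) + J 1 1 * v₀ 0 ^ 2)
          + w₁ * x ^ (d₁ - e) * (v₁ 0 * v₀ 1 - v₁ 1 * v₀ 0) ^ 2 + w₂ * x ^ (d₂ - e) * (v₂ 0 * v₀ 1 - v₂ 1 * v₀ 0) ^ 2
          + w₃ * x ^ (d₃ - e) * (v₃ 0 * v₀ 1 - v₃ 1 * v₀ 0) ^ 2) := by
      rw [hp1, hp2, hp3]; ring
    rw [hid]
    exact mul_neg_of_pos_of_neg (pow_pos hx e) hred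
  exact eval_det_neg_of_neg_direction e d₀ d₁ d₂ d₃ J hJ hdJ v₀ v₁ v₂ v₃ w₀ w₁ w₂ w₃ hw₀ hw₁ hw₂ hw₃ x hx (v₀ 1) (-v₀ 0) hz

end Summit.ValiantsHypothesis.ValiantsHypothesis.Theorems.LacunarySymmetroidMatrixDescartes.Pivot.NullDirection
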